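import Literature.NumberTheory.Irrationality.Fischler2002.BeukersSorokinChangeOfVariables
import HarnessLib

/-!
# Fischler's generalisation of the Rhin–Viola groups to `n`-fold integrals (Fischler 2002 §3, 2003 §§3–4)

Topic `Literature/NumberTheory/Irrationality/Fischler2002`. Typed, cited statements (named facts, D-0014;
`Jn_sigma` is PROVED at the end of this file) from S. Fischler, « Formes linéaires en polyzêtas et intégrales
multiples », C. R. Acad. Sci. Paris, Sér. I **335** (2002) 1–4 = arXiv:math/0202064 [Fischler2002Polyzetas],
§3 « Une généralisation du groupe de Rhin-Viola » (general `n ≥ 2`), with the proofs and the refereed wording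
of S. Fischler, *Groupes de Rhin-Viola et intégrales multiples*, J. Théor. Nombres Bordeaux **15** (2003)
479–534 [Fischler2003RhinViola],
§3 (Prop. 9–12, Th. 5–6) and §4 (Prop. 13–15, Th. 8). PRIMARY SOURCES read on the page: arXiv text
`paper:arxiv-math_0202064` pp. 3–4 (all formulas below are transcribed from it) and the journal scan
`paper:url-3c064f6d9737` (text layer; displayed formulas not legible) pp. 481, 507–516, 520–524 for the
numbering, the hypotheses of the hypergeometric transformations and the group orders. This is the GENERAL-`n`
companion of `FamilyJ.lean` (which vendors the `n = 5` finiteness criterion used by the cell pub-zeta5) and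
closes that file's `TODO(general form)`. Cell zeta5-irr (HONEST FRAMING: systematic search; no irrationality
claim unless certified): serves zi-p1's purpose line « Sorokin-type, totally symmetric Rhin–Viola-style
groups » with the printed group structure in EVERY dimension — including the printed NEGATIVE datum
[Fischler2003RhinViola, §3.4 after Th. 6]: « On aimerait obtenir un groupe dont la structure soit de plus en
plus riche quand n augmente ; ici, le théorème 6 montre qu'on n'y parvient pas » (order `72` for all `n ≥ 4`).

[cite: Fischler2003RhinViola, Introduction p. 481 (Définition)]: "On dit qu'une famille de nombres
`I(p) ∈ ℝ₊* ∪ {∞}` paramétrés par `p ∈ ℤ^s`, admet pour groupe de Rhin-Viola un sous-groupe `G` de `GL_s(ℤ)` si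
`I(gp)/I(p)` est un rationnel (ou `∞`) pour tous `g ∈ G` et `p ∈ ℤ^s` (avec `∞/∞ = 1`)." (The note's Déf. 1.1
says « un rationnel non nul ».)

[cite: Fischler2002Polyzetas, §3 pp. 3–4]: "À tout `p = (a₁,…,a_n,b₁,…,b_n,c₂,…,c_n) ∈ ℤ^{3n−1}` on associe
`𝒥(p) = ∫_{[0,1]^n} ∏_{k=1}^n x_k^{a_k}(1−x_k)^{b_k} / ∏_{k=2}^n δ_k(x)^{c_k} · dx₁…dx_n/δ_n(x)`
[`δ_k = 1 − x_k δ_{k−1}`, `δ₀ = 1`]. On pose `ρ_n = c_n − b_n` et `ρ_{n−1} = c_{n−1} − 1 − b_{n−1}`, puis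
`ρ_k = ρ⁺_{k+2} + c_k − 1 − b_k` pour tout `k ∈ {1,…,n−2}` en notant `α⁺ = max(α,0)` et avec la convention
`c₁ = 1`. Alors l'intégrale `𝒥(p)` est finie [si et seulement si] on a `a_k ≥ 0`, `b_k ≥ 0` et `ρ_k ≤ a_{k−1}`
pour tout `k ∈ {1,…,n}`, avec la convention `a₀ = 0`. Notons `σ` l'automorphisme de `ℤ^{3n−1}` qui échange `a₁`
et `b₂`, ainsi que `a₂` et `b₁`, en fixant les autres coordonnées. Notons `ψ` celui qui à `p` associe `p'`
défini par : `a'_k = a_{n+1−k}` pour `1 ≤ k ≤ n`, `b'_k = b_{n+2−k}` pour `2 ≤ k ≤ n` et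
`b'₁ = a_{n−1} + b_n − c_n`, `c'_k = a_{n+2−k} + b_{n+2−k} + c_{n+1−k} − b_{n+1−k} − a_{n−k}` pour
`2 ≤ k ≤ n−1`, `c'_n = a₂ + b₂ − b₁`. Alors des changements de variables montrent qu'on a
`𝒥(p) = 𝒥(σ(p)) = 𝒥(ψ(p))` pour tout `p`. En outre, notons `χ` l'automorphisme de `ℤ^{3n−1}` qui fixe toutes
les composantes, sauf `a_n` et `c_n` qu'il échange et `b_n` qu'il remplace par `a_n + b_n − c_n` ; il vérifie
`𝒥(p) = a_n! b_n!/(c_n! (a_n+b_n−c_n)!) · 𝒥(χ(p))` pour tout `p`. **Proposition 3.1.** Si `n ≥ 3`, la famille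
`(𝒥(p))` admet un groupe de Rhin-Viola d'ordre 32, isomorphe à `(D₂ × D₂) ⋊ ℤ/2ℤ`, qui est engendré par
`σ`, `ψ` et `χ`. … on peut se restreindre aux intégrales `𝒥(p)` telles que `c₂ = … = c_{n−1} = 0`. Pour
conserver l'action de `σ` et `ψ`, on doit imposer en outre `a₁ + b₂ = a₃ + b₃` si `n = 3`, et les relations
suivantes si `n ≥ 4` : `a₂ = b₁` et `b_n = c_n` et `a_k + b_{k+1} = a_{k+2} + b_{k+2}` pour tout
`k ∈ {1,…,n−2}`. On note `𝓔` l'ensemble des `p` vérifiant ces relations … Notons `φ` l'automorphisme de `𝓔` qui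
stabilise toutes les coordonnées, sauf `a_{n−1}` et `c_n` qu'il échange, `b_{n−1}` qu'il remplace par
`a_{n−1} + b_{n−1} − c_n` et `b_n` qu'il remplace par `a_{n−1} + b_n − c_n`. On a alors
`𝒥(p) = a_{n−1}! b_{n−1}!/(c_n! (a_{n−1}+b_{n−1}−c_n)!) · 𝒥(φ(p))`. **Théorème 3.2.** La famille des `𝒥(p)`,
pour `p ∈ 𝓔`, admet un groupe de Rhin-Viola `G` engendré par `σ`, `ψ` et `φ`. Plus précisément : pour `n ≥ 4`,
ce groupe est isomorphe à `(𝔖₃ × 𝔖₃) ⋊ ℤ/2ℤ`, donc d'ordre 72 ; il laisse stable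
`𝒥(p)/(a_{n−1}! b_{n−1}! a₂! b₃!)` si `n ≥ 5`, et `𝒥(p)/(a₃! b₃! a₂!)` si `n = 4`. Pour `n = 3`, le groupe
`G` est isomorphe à `H ⋊ 𝔖₅`, où `H` est l'hyperplan `ε₁ + … + ε₅ = 0` de `(ℤ/2ℤ)⁵` ; il laisse stable
`𝒥(p)/(a₁! a₂! a₃! b₁! b₂! b₃! (a₂+b₃−c₃)! (b₁+b₃−c₃)!)`. Pour `n = 2`, le groupe `G` est isomorphe à `𝔖₅`,
et laisse stable `𝒥(p)/(a₁! a₂! b₁! b₂! (a₁+b₂−c₂)!)`." Orders: [cite: Fischler2003RhinViola, §3.4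
Théorème 6 p. 515]: "`G` est un groupe fini, isomorphe : à `𝔖₅` si `n = 2`, donc d'ordre 120 ; à `H ⋊ 𝔖₅`
si `n = 3`, donc d'ordre 1920 ; à `(𝔖₃ × 𝔖₃) ⋊ ℤ/2ℤ` si `n ≥ 4`, donc d'ordre 72."

RENDERING (tree vocabulary; imports the §2 file for `coord`, `unitCube`, `Exponents`, `deltaV`).
* `𝒥(p) ∈ ℝ₊ ∪ {∞}` is a lower Lebesgue integral (`Jn n p : ℝ≥0∞`), integer exponents via `zpow`, as in the
  §2 file; "finie" is `≠ ∞`. The recursion for `ρ_k` is the uniform one of the journal version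
  [Fischler2003RhinViola, §4.1]: `ρ_{n+1} = ρ_{n+2} = 0`, `ρ_k = ρ⁺_{k+2} + c̃_k − 1 − b_k` with `c̃₁ = 1`,
  `c̃_n = c_n + 1`, `c̃_k = c_k` otherwise — which unfolds to the note's three displayed cases (`rho`).
* The maps `σ, ψ, χ, φ` are typed on the record `Exponents = (a, b, c : ℕ → ℤ)` so as to act EXACTLY on the
  printed coordinates `a₁..a_n, b₁..b_n, c₂..c_n` and to fix every other (inert) coordinate; the groups of the
  statements are the subgroups of `Equiv.Perm` generated by them, which are therefore isomorphic to the printed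
  subgroups of `GL_{3n−1}(ℤ)` (resp. `Aut 𝓔`). That these maps ARE automorphisms (involutions) is part of the
  printed claims and is carried by the existential over `Equiv.Perm` in `prop31` / `theoreme32` (`σ`, `χ`
  involutive: PROVED below); the isomorphism types `(D₂×D₂)⋊ℤ/2`, `(𝔖₃×𝔖₃)⋊ℤ/2`, `H⋊𝔖₅`, `𝔖₅` are
  recorded in the docstrings, the typed content being the ORDERS `32 / 72 / 1920 / 120` and the Rhin–Viola
  property. TRANSCRIPTION CHECK by the filing seat (exact integer arithmetic, scratch script, not a
  certificate): with the maps exactly as typed here, `σ, ψ, χ, φ` are involutions of `ℤ^{3n−1}`, `σ, ψ, φ`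
  preserve `𝓔`, `⟨σ, ψ, χ⟩ ≤ GL_{3n−1}(ℤ)` has order `32` for `n = 3,…,7` (and `120` for `n = 2`), and
  `⟨σ, ψ, φ⟩` acting on `𝓔` has order `120, 1920, 72, 72, 72, 72` for `n = 2,…,7` — the printed orders.
* The hypergeometric transformations `χ`, `φ` are typed with the hypotheses of the journal version
  [Fischler2003RhinViola, Prop. 15 and Prop. 12]: convergence of `𝒥(p)` and `c_n ≥ 0`, `a_n+b_n−c_n ≥ 0`
  (resp. `c_n ≥ 0`, `a_{n−1}+b_{n−1}−c_n ≥ 0`, with `c₂ = ⋯ = c_{n−1} = 0`), so that the factorials are of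
  natural numbers (`Int.toNat`); the note states them « pour tout p ».
* "il laisse stable `𝒥(p)/(…)`" is typed for pairs `p, g p ∈ 𝓔` that BOTH satisfy the finiteness criterion
  (then all factorial arguments are `≥ 0` by the criterion and the relations of `𝓔`): a faithful special
  case of the printed invariance (the journal's Théorème 5 states it on the set `𝓔⁺` of parameters whose
  whole orbit converges).
PROVED here (last section; a proof OF the cited statement, no new statement): `Jn_sigma_holds : Jn_sigma` —
  the `σ`-invariance `𝒥(σ(p)) = 𝒥(p)` for every `n ≥ 2` by the measure-preserving involution
  `x₁ ↦ 1 − x₂, x₂ ↦ 1 − x₁` of `[0,1]^n`. The other named facts of this file remain statements.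
NOT here: the automorphism-group interpretation of parts 1–2 of the journal paper (the varieties `V₂, V₃`),
§3.5 Théorème 7 (parity of the zeta values occurring — Zudilin's theorem, the tree's `Zudilin2002` files),
the order-32 group of the Sorokin-type family `𝓛` (note Prop. 2.3 = journal Th. 9, generators only described
in the held texts).
-/

noncomputable section

open MeasureTheory Set Finset
open scoped ENNReal

namespace Literature.NumberTheory.Irrationality.Fischler2002

/-! ### Rhin–Viola groups of a family of (possibly infinite) numbers -/

/-- **Rhin–Viola group of a family** (journal wording): a family `I(p) ∈ ℝ₊ ∪ {∞}` indexed by `p : X`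
*admits* the group `G` of permutations of the parameters as a Rhin–Viola group if `I(gp)/I(p)` is a rational
number or `∞` for all `g ∈ G`, `p` (with `∞/∞ = 1`) — i.e. whenever both values are finite, their ratio is
rational. (In print `X = ℤ^s` and `G ≤ GL_s(ℤ)`; the note's Déf. 1.1 asks « un rationnel non nul ».)
[cite: Fischler2003RhinViola, Introduction p. 481 (Définition)] [cite: Fischler2002Polyzetas, §1 Définition 1.1] -/
def IsRhinViolaGroup {X : Type*} (I : X → ℝ≥0∞) (G : Subgroup (Equiv.Perm X)) : Prop :=
  ∀ g ∈ G, ∀ p : X, I p ≠ ∞ → I (g p) ≠ ∞ → ∃ q : ℚ, I (g p) = ENNReal.ofReal q * I p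

/-! ### The family `𝒥(p)` for general `n` -/

/-- The integrand of `𝒥(p)`: `∏_{k=1}^n x_k^{a_k}(1−x_k)^{b_k} / ∏_{k=2}^n δ_k(x)^{c_k} · 1/δ_n(x)` (integer
powers; `δ_k` = `deltaV`). [cite: Fischler2002Polyzetas, §3 p. 3 (definition of 𝒥(p))] -/
def integrandJ (n : ℕ) (p : Exponents) (x : Fin n → ℝ) : ℝ :=
  (∏ k ∈ Finset.Icc 1 n, coord x k ^ p.a k * (1 - coord x k) ^ p.b k) /
      (∏ k ∈ Finset.Icc 2 n, deltaV x k ^ p.c k) / deltaV x n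

/-- `𝒥(p) ∈ ℝ₊ ∪ {∞}` for `p ∈ ℤ^{3n−1}` (lower Lebesgue integral over `[0,1]^n`; for `n = 5` this is the
integral of `FamilyJ.lean`, there as a Bochner integral). [cite: Fischler2002Polyzetas, §3 p. 3 (definition of 𝒥(p))] -/
def Jn (n : ℕ) (p : Exponents) : ℝ≥0∞ := ∫⁻ x in unitCube n, ENNReal.ofReal (integrandJ n p x)

/-- `c̃_k`: `c̃₁ = 1` (the convention `c₁ = 1`), `c̃_n = c_n + 1` (the extra factor `1/δ_n`), `c̃_k = c_k`
otherwise. [cite: Fischler2003RhinViola, §4.1 p. 521 (notation c̃)] -/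
def cTilde (n : ℕ) (p : Exponents) (k : ℕ) : ℤ :=
  if k = 1 then 1 else if k = n then p.c n + 1 else p.c k

/-- Fischler's `ρ_k` (`1 ≤ k ≤ n`; `ρ_k = 0` for `k > n`): `ρ_k = ρ⁺_{k+2} + c̃_k − 1 − b_k`, i.e.
`ρ_n = c_n − b_n`, `ρ_{n−1} = c_{n−1} − 1 − b_{n−1}`, `ρ_k = ρ⁺_{k+2} + c_k − 1 − b_k` (`k ≤ n−2`, `c₁ = 1`).
[cite: Fischler2002Polyzetas, §3 p. 3 (definition of ρ_k)] [cite: Fischler2003RhinViola, §4.1 p. 521] -/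
def rho (n : ℕ) (p : Exponents) (k : ℕ) : ℤ :=
  if h : n < k then 0 else max (rho n p (k + 2)) 0 + cTilde n p k - 1 - p.b k
termination_by n + 1 - k
decreasing_by omega

/-- Fischler's finiteness criterion for `𝒥(p)`: `a_k ≥ 0`, `b_k ≥ 0` and `ρ_k ≤ a_{k−1}` for all
`k ∈ {1,…,n}`, with `a₀ = 0`. [cite: Fischler2002Polyzetas, §3 p. 3 (critère de finitude)] -/
def FinitenessCriterionGen (n : ℕ) (p : Exponents) : Prop :=
  (∀ k ∈ Finset.Icc 1 n, 0 ≤ p.a k) ∧ (∀ k ∈ Finset.Icc 1 n, 0 ≤ p.b k) ∧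
    ∀ k ∈ Finset.Icc 1 n, rho n p k ≤ (if k = 1 then 0 else p.a (k - 1))

/-- **Fischler 2002 §3 / 2003 Prop. 13, finiteness criterion for general `n`** (named fact, statement only;
a THEOREM in print): for `n ≥ 2` and `p ∈ ℤ^{3n−1}`, `𝒥(p)` is finite iff `a_k ≥ 0`, `b_k ≥ 0` and
`ρ_k ≤ a_{k−1}` for all `k ∈ {1,…,n}` (`a₀ = 0`).
[cite: Fischler2002Polyzetas, §3 p. 3 (critère de finitude de 𝒥(p))] [cite: Fischler2003RhinViola, §4.1 Proposition 13 p. 521] -/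
def Jn_finite_iff : Prop :=
  ∀ (n : ℕ) (p : Exponents), 2 ≤ n → (Jn n p ≠ ∞ ↔ FinitenessCriterionGen n p)

/-! ### The transformations `σ, ψ, χ, φ` -/

/-- `σ`: exchanges `a₁ ↔ b₂` and `a₂ ↔ b₁`, fixes the other coordinates.
[cite: Fischler2002Polyzetas, §3 p. 3 (definition of σ)] -/
def sigma (p : Exponents) : Exponents where
  a := fun k => if k = 1 then p.b 2 else if k = 2 then p.b 1 else p.a k
  b := fun k => if k = 1 then p.a 2 else if k = 2 then p.a 1 else p.b k
  c := p.c

/-- `ψ`: `a'_k = a_{n+1−k}` (`1 ≤ k ≤ n`); `b'_k = b_{n+2−k}` (`2 ≤ k ≤ n`), `b'₁ = a_{n−1} + b_n − c_n`;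
`c'_k = a_{n+2−k} + b_{n+2−k} + c_{n+1−k} − b_{n+1−k} − a_{n−k}` (`2 ≤ k ≤ n−1`), `c'_n = a₂ + b₂ − b₁`;
other coordinates fixed. [cite: Fischler2002Polyzetas, §3 p. 3 (definition of ψ)] -/
def psi (n : ℕ) (p : Exponents) : Exponents where
  a := fun k => if 1 ≤ k ∧ k ≤ n then p.a (n + 1 - k) else p.a k
  b := fun k =>
    if k = 1 then p.a (n - 1) + p.b n - p.c n
    else if 2 ≤ k ∧ k ≤ n then p.b (n + 2 - k) else p.b k
  c := fun k =>
    if 2 ≤ k ∧ k ≤ n - 1 then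
      p.a (n + 2 - k) + p.b (n + 2 - k) + p.c (n + 1 - k) - p.b (n + 1 - k) - p.a (n - k)
    else if k = n then p.a 2 + p.b 2 - p.b 1 else p.c k

/-- `χ`: exchanges `a_n ↔ c_n` and replaces `b_n` by `a_n + b_n − c_n`; fixes the other coordinates.
[cite: Fischler2002Polyzetas, §3 p. 3 (definition of χ)] -/
def chi (n : ℕ) (p : Exponents) : Exponents where
  a := fun k => if k = n then p.c n else p.a k
  b := fun k => if k = n then p.a n + p.b n - p.c n else p.b k
  c := fun k => if k = n then p.a n else p.c k

/-- `φ`: exchanges `a_{n−1} ↔ c_n`, replaces `b_{n−1}` by `a_{n−1} + b_{n−1} − c_n` and `b_n` by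
`a_{n−1} + b_n − c_n`; fixes the other coordinates. [cite: Fischler2002Polyzetas, §3 p. 4 (definition of φ)] -/
def phi (n : ℕ) (p : Exponents) : Exponents where
  a := fun k => if k = n - 1 then p.c n else p.a k
  b := fun k =>
    if k = n - 1 then p.a (n - 1) + p.b (n - 1) - p.c n
    else if k = n then p.a (n - 1) + p.b n - p.c n else p.b k
  c := fun k => if k = n then p.a (n - 1) else p.c k

/-- **`𝒥` is invariant under `σ`** (named fact; a THEOREM in print — the change of variables
`x₁ ↦ 1 − x₂, x₂ ↦ 1 − x₁` — PROVED below in this file for every `n ≥ 2` as `Jn_sigma_holds`; users' hypotheses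
`(h : Jn_sigma)` are fed that theorem): `𝒥(σ(p)) = 𝒥(p)` for all `n ≥ 2`, `p ∈ ℤ^{3n−1}` (in `ℝ₊ ∪ {∞}`).
For `n = 5` also proved tree-side (`Summits/…/Zeta5Search/SorokinCensus/Generalized.lean`, `sigmaIdentity_holds`).
[cite: Fischler2002Polyzetas, §3 p. 3 (𝒥(p) = 𝒥(σ(p)))] [cite: Fischler2003RhinViola, §4.2 Proposition 14 (with Prop. 10)] -/
def Jn_sigma : Prop :=
  ∀ (n : ℕ) (p : Exponents), 2 ≤ n → Jn n (sigma p) = Jn n p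

/-- **`𝒥` is invariant under `ψ`** (named fact, statement only; a THEOREM in print — an involutive change of
variables): `𝒥(ψ(p)) = 𝒥(p)` for all `n ≥ 2`, `p ∈ ℤ^{3n−1}`. For `n = 5` PROVED tree-side
(`reversalIdentity_holds`). [cite: Fischler2002Polyzetas, §3 p. 3 (𝒥(p) = 𝒥(ψ(p)))] [cite: Fischler2003RhinViola, §4.2 Proposition 14 (with Prop. 11)] -/
def Jn_psi : Prop :=
  ∀ (n : ℕ) (p : Exponents), 2 ≤ n → Jn n (psi n p) = Jn n p

/-- **The hypergeometric transformation `χ`** (named fact, statement only; a THEOREM in print — Euler's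
transformation `∫₀¹ x^a(1−x)^b/(1+βx)^{c+1} = a!b!/(c!(a+b−c)!) ∫₀¹ x^c(1−x)^{a+b−c}/(1+βx)^{a+1}` in the
variable `x_n`): for `n ≥ 2` and `p ∈ ℤ^{3n−1}` satisfying the finiteness criterion with `c_n ≥ 0` and
`a_n + b_n − c_n ≥ 0`, `𝒥(p) = a_n! b_n!/(c_n! (a_n+b_n−c_n)!) · 𝒥(χ(p))` (hypotheses as in the journal
version; the note writes « pour tout p »). [cite: Fischler2002Polyzetas, §3 p. 3 (formule pour χ)] [cite: Fischler2003RhinViola, §4.2 Proposition 15 pp. 523–524] -/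
def Jn_chi : Prop :=
  ∀ (n : ℕ) (p : Exponents), 2 ≤ n → FinitenessCriterionGen n p → 0 ≤ p.c n → 0 ≤ p.a n + p.b n - p.c n →
    Jn n p =
      ENNReal.ofReal (((p.a n).toNat.factorial * (p.b n).toNat.factorial : ℕ) /
          ((p.c n).toNat.factorial * (p.a n + p.b n - p.c n).toNat.factorial : ℕ)) *
        Jn n (chi n p)

/-- **The hypergeometric transformation `φ`** (named fact, statement only; a THEOREM in print — the same Euler
transformation in the variable `x_{n−1}`, available when `c₂ = ⋯ = c_{n−1} = 0`): for `n ≥ 2` and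
`p ∈ ℤ^{3n−1}` with `c_k = 0` (`2 ≤ k ≤ n−1`) satisfying the finiteness criterion with `c_n ≥ 0` and
`a_{n−1} + b_{n−1} − c_n ≥ 0`, `𝒥(p) = a_{n−1}! b_{n−1}!/(c_n! (a_{n−1}+b_{n−1}−c_n)!) · 𝒥(φ(p))`.
[cite: Fischler2002Polyzetas, §3 p. 4 (formule pour φ)] [cite: Fischler2003RhinViola, §3.2 Proposition 12 p. 511] -/
def Jn_phi : Prop :=
  ∀ (n : ℕ) (p : Exponents), 2 ≤ n → (∀ k, 2 ≤ k → k ≤ n - 1 → p.c k = 0) → FinitenessCriterionGen n p →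
    0 ≤ p.c n → 0 ≤ p.a (n - 1) + p.b (n - 1) - p.c n →
    Jn n p =
      ENNReal.ofReal (((p.a (n - 1)).toNat.factorial * (p.b (n - 1)).toNat.factorial : ℕ) /
          ((p.c n).toNat.factorial * (p.a (n - 1) + p.b (n - 1) - p.c n).toNat.factorial : ℕ)) *
        Jn n (phi n p)

/-! ### Proposition 3.1: the group of order 32 -/

/-- **Fischler 2002, Proposition 3.1** (= journal Théorème 8) (named fact, statement only; a THEOREM in print):
for `n ≥ 3`, `σ`, `ψ`, `χ` are automorphisms of `ℤ^{3n−1}` generating a group of order `32` (isomorphic to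
`(D₂ × D₂) ⋊ ℤ/2ℤ`, `D₂` the Klein group — isomorphism type not typed), which is a Rhin–Viola group for the
family `𝒥`. [cite: Fischler2002Polyzetas, §3 Proposition 3.1] [cite: Fischler2003RhinViola, §4.3 Théorème 8 p. 524] -/
def prop31 : Prop :=
  ∀ n : ℕ, 3 ≤ n →
    ∃ σ' ψ' χ' : Equiv.Perm Exponents, ⇑σ' = sigma ∧ ⇑ψ' = psi n ∧ ⇑χ' = chi n ∧
      Nat.card (Subgroup.closure ({σ', ψ', χ'} : Set (Equiv.Perm Exponents))) = 32 ∧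
      IsRhinViolaGroup (Jn n) (Subgroup.closure ({σ', ψ', χ'} : Set (Equiv.Perm Exponents)))

/-! ### Théorème 3.2: the restricted family `𝓔` and the groups of order `72 / 1920 / 120` -/

/-- The sub-`ℤ`-module `𝓔`: `c₂ = ⋯ = c_{n−1} = 0`, and `a₁ + b₂ = a₃ + b₃` if `n = 3`, resp. `a₂ = b₁`,
`b_n = c_n`, `a_k + b_{k+1} = a_{k+2} + b_{k+2}` (`1 ≤ k ≤ n−2`) if `n ≥ 4` (no relation beyond the `c`'s if
`n = 2`). [cite: Fischler2002Polyzetas, §3 p. 4 (definition of 𝓔)] -/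
def InE (n : ℕ) (p : Exponents) : Prop :=
  (∀ k, 2 ≤ k → k ≤ n - 1 → p.c k = 0) ∧
    (n = 3 → p.a 1 + p.b 2 = p.a 3 + p.b 3) ∧
    (4 ≤ n → p.a 2 = p.b 1 ∧ p.b n = p.c n ∧ ∀ k, 1 ≤ k → k ≤ n - 2 → p.a k + p.b (k + 1) = p.a (k + 2) + p.b (k + 2))

/-- The normalising product of factorials of Théorème 3.2: `a_{n−1}! b_{n−1}! a₂! b₃!` (`n ≥ 5`),
`a₃! b₃! a₂!` (`n = 4`), `a₁! a₂! a₃! b₁! b₂! b₃! (a₂+b₃−c₃)! (b₁+b₃−c₃)!` (`n = 3`),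
`a₁! a₂! b₁! b₂! (a₁+b₂−c₂)!` (`n = 2`) — integer arguments truncated by `Int.toNat` (they are `≥ 0`
whenever `𝒥(p)` is finite, `p ∈ 𝓔`). [cite: Fischler2002Polyzetas, §3 Théorème 3.2] -/
def rvNormaliser (n : ℕ) (p : Exponents) : ℕ :=
  if n = 2 then
    (p.a 1).toNat.factorial * (p.a 2).toNat.factorial * (p.b 1).toNat.factorial * (p.b 2).toNat.factorial *
      (p.a 1 + p.b 2 - p.c 2).toNat.factorial
  else if n = 3 then
    (p.a 1).toNat.factorial * (p.a 2).toNat.factorial * (p.a 3).toNat.factorial *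
      (p.b 1).toNat.factorial * (p.b 2).toNat.factorial * (p.b 3).toNat.factorial *
      (p.a 2 + p.b 3 - p.c 3).toNat.factorial * (p.b 1 + p.b 3 - p.c 3).toNat.factorial
  else if n = 4 then
    (p.a 3).toNat.factorial * (p.b 3).toNat.factorial * (p.a 2).toNat.factorial
  else
    (p.a (n - 1)).toNat.factorial * (p.b (n - 1)).toNat.factorial * (p.a 2).toNat.factorial *
      (p.b 3).toNat.factorial

/-- The printed order of the Rhin–Viola group `G = ⟨σ, ψ, φ⟩` of the family `(𝒥(p))_{p ∈ 𝓔}`: `120` (`n = 2`,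
`G ≅ 𝔖₅`), `1920` (`n = 3`, `G ≅ H ⋊ 𝔖₅`), `72` (`n ≥ 4`, `G ≅ (𝔖₃ × 𝔖₃) ⋊ ℤ/2ℤ`).
[cite: Fischler2003RhinViola, §3.4 Théorème 6 p. 515] [cite: Fischler2002Polyzetas, §3 Théorème 3.2] -/
def rvGroupOrder (n : ℕ) : ℕ := if n = 2 then 120 else if n = 3 then 1920 else 72

/-- **Fischler 2002, Théorème 3.2** (= journal Théorèmes 5–6) (named fact, statement only; a THEOREM in
print): for `n ≥ 2`, the maps `σ`, `ψ`, `φ` restrict to permutations of `𝓔`; the group `G` they generate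
there is a Rhin–Viola group for `(𝒥(p))_{p∈𝓔}`, of order `120` (`n = 2`), `1920` (`n = 3`), `72` (`n ≥ 4`);
and it leaves `𝒥(p)` divided by the normalising factorials (`rvNormaliser`) invariant — typed for pairs
`p, gp` both satisfying the finiteness criterion. (Isomorphism types `𝔖₅`, `H ⋊ 𝔖₅`, `(𝔖₃×𝔖₃)⋊ℤ/2ℤ` not
typed.) [cite: Fischler2002Polyzetas, §3 Théorème 3.2] [cite: Fischler2003RhinViola, §3.3 Théorème 5 p. 512 and §3.4 Théorème 6 p. 515] -/
def theoreme32 : Prop :=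
  ∀ n : ℕ, 2 ≤ n →
    ∃ σ' ψ' φ' : Equiv.Perm {p : Exponents // InE n p},
      (∀ p, (σ' p).1 = sigma p.1) ∧ (∀ p, (ψ' p).1 = psi n p.1) ∧ (∀ p, (φ' p).1 = phi n p.1) ∧
      IsRhinViolaGroup (fun p => Jn n p.1)
        (Subgroup.closure ({σ', ψ', φ'} : Set (Equiv.Perm {p : Exponents // InE n p}))) ∧
      Nat.card (Subgroup.closure ({σ', ψ', φ'} : Set (Equiv.Perm {p : Exponents // InE n p}))) =
        rvGroupOrder n ∧
      ∀ g ∈ Subgroup.closure ({σ', ψ', φ'} : Set (Equiv.Perm {p : Exponents // InE n p})),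
        ∀ p : {p : Exponents // InE n p},
          FinitenessCriterionGen n p.1 → FinitenessCriterionGen n (g p).1 →
            Jn n (g p).1 / (rvNormaliser n (g p).1 : ℝ≥0∞) = Jn n p.1 / (rvNormaliser n p.1 : ℝ≥0∞)

/-! ### Small checks of the transcription (involutivity on the printed coordinates) -/

/-- `σ` is an involution. [cite: Fischler2002Polyzetas, §3 p. 3 (σ « automorphisme »)] -/
theorem sigma_sigma (p : Exponents) : sigma (sigma p) = p := by
  cases p with
  | mk a b c =>
    simp only [sigma, Exponents.mk.injEq]
    refine ⟨?_, ?_, trivial⟩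
    · funext k
      by_cases h1 : k = 1
      · subst h1; simp
      · by_cases h2 : k = 2
        · subst h2; simp
        · simp [h1, h2]
    · funext k
      by_cases h1 : k = 1
      · subst h1; simp
      · by_cases h2 : k = 2
        · subst h2; simp
        · simp [h1, h2]

/-- `χ` is an involution. [cite: Fischler2002Polyzetas, §3 p. 3 (χ « automorphisme »)] -/
theorem chi_chi (n : ℕ) (p : Exponents) : chi n (chi n p) = p := by
  cases p with
  | mk a b c =>
    simp only [chi, Exponents.mk.injEq]
    refine ⟨?_, ?_, ?_⟩
    · funext k
      by_cases h : k = n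
      · subst h; simp
      · simp [h]
    · funext k
      by_cases h : k = n
      · subst h; simp
      · simp [h]
    · funext k
      by_cases h : k = n
      · subst h; simp
      · simp [h]

/-! ### Proof of `Jn_sigma` (discharge): the change of variables `x₁ ↦ 1 − x₂`, `x₂ ↦ 1 − x₁`

[cite: Fischler2003RhinViola, §4.2 Proposition 14 (with Prop. 10)] and [cite: Fischler2002Polyzetas,
§3 p. 3]: « des changements de variables montrent qu'on a `𝒥(p) = 𝒥(σ(p))` ». The change of variables for `σ`
is the affine involution of `[0,1]^n` given by `x₁ ↦ 1 − x₂`, `x₂ ↦ 1 − x₁` (other coordinates fixed): it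
preserves Lebesgue measure and the cube, fixes `δ_k` for every `k ≥ 2` (these see `x₁, x₂` only through
`δ₂ = 1 − x₂(1 − x₁) = 1 − (1 − x₁)x₂`) and exchanges the four factors `x₁^{a₁}(1−x₁)^{b₁}x₂^{a₂}(1−x₂)^{b₂}`
exactly as `σ` exchanges `a₁ ↔ b₂`, `a₂ ↔ b₁`. No convergence hypothesis is used: the identity holds in
`ℝ₊ ∪ {∞}`, as typed. (For `n = 5` the same argument is the cell's tree-side `sigmaInvariance_holds`, which
Literature does not import.) To keep this a proof-only append, the map is not given a name: the lemmas below
speak of any `σ : (Fin n → ℝ) → (Fin n → ℝ)` satisfying the pointwise description `hσ` on two indices `i ≠ j`,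
later specialised to `i = ⟨0,_⟩`, `j = ⟨1,_⟩` (i.e. the printed `x₁, x₂`). -/

section JnSigmaProof

variable {n : ℕ} {i j : Fin n} {σ : (Fin n → ℝ) → (Fin n → ℝ)}

/-- `(σx)_i = 1 − x_j`. [cite: Fischler2003RhinViola, §4.2 Proposition 14 (with Prop. 10)] -/
private theorem swapReflect_apply_left
    (hσ : ∀ x t, σ x t = if t = i then 1 - x j else if t = j then 1 - x i else x t) (x : Fin n → ℝ) :
    σ x i = 1 - x j := by
  rw [hσ, if_pos rfl]

/-- `(σx)_j = 1 − x_i`. [cite: Fischler2003RhinViola, §4.2 Proposition 14 (with Prop. 10)] -/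
private theorem swapReflect_apply_right
    (hσ : ∀ x t, σ x t = if t = i then 1 - x j else if t = j then 1 - x i else x t) (hij : i ≠ j)
    (x : Fin n → ℝ) : σ x j = 1 - x i := by
  rw [hσ, if_neg (Ne.symm hij), if_pos rfl]

/-- `(σx)_t = x_t` for `t ∉ {i, j}`. [cite: Fischler2003RhinViola, §4.2 Proposition 14 (with Prop. 10)] -/
private theorem swapReflect_apply_of_ne
    (hσ : ∀ x t, σ x t = if t = i then 1 - x j else if t = j then 1 - x i else x t) {t : Fin n}
    (hti : t ≠ i) (htj : t ≠ j) (x : Fin n → ℝ) : σ x t = x t := by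
  rw [hσ, if_neg hti, if_neg htj]

/-- `σ` is an involution. [cite: Fischler2003RhinViola, §4.2 Proposition 14 (with Prop. 10)] -/
private theorem swapReflect_involutive
    (hσ : ∀ x t, σ x t = if t = i then 1 - x j else if t = j then 1 - x i else x t) (hij : i ≠ j) :
    Function.Involutive σ := by
  intro x
  funext t
  by_cases hti : t = i
  · rw [hti, swapReflect_apply_left hσ, swapReflect_apply_right hσ hij]; ring
  · by_cases htj : t = j
    · rw [htj, swapReflect_apply_right hσ hij, swapReflect_apply_left hσ]; ring
    · rw [swapReflect_apply_of_ne hσ hti htj, swapReflect_apply_of_ne hσ hti htj]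

/-- `σ` is measurable. [folklore] -/
private theorem measurable_swapReflect
    (hσ : ∀ x t, σ x t = if t = i then 1 - x j else if t = j then 1 - x i else x t) : Measurable σ := by
  refine measurable_pi_iff.mpr fun t => ?_
  by_cases hti : t = i
  · have h : (fun x => σ x t) = fun x => 1 - x j := funext fun x => by rw [hσ, if_pos hti]
    rw [h]; fun_prop
  · by_cases htj : t = j
    · have h : (fun x => σ x t) = fun x => 1 - x i := funext fun x => by rw [hσ, if_neg hti, if_pos htj]
      rw [h]; fun_prop
    · have h : (fun x => σ x t) = fun x => x t := funext fun x => by rw [hσ, if_neg hti, if_neg htj]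
      rw [h]; exact measurable_pi_apply t

/-- `σ` = (swap the coordinates `i, j`) ∘ (reflect the coordinates `i, j`), hence it preserves Lebesgue measure
on `ℝ^n`. [folklore] -/
private theorem measurePreserving_swapReflect
    (hσ : ∀ x t, σ x t = if t = i then 1 - x j else if t = j then 1 - x i else x t) (hij : i ≠ j) :
    MeasurePreserving σ volume volume := by
  let f : Fin n → ℝ → ℝ := fun t s => if t = i ∨ t = j then 1 - s else s
  have hf : ∀ t, MeasurePreserving (f t) volume volume := by
    intro t
    by_cases h : t = i ∨ t = j
    · have e : f t = fun s => 1 - s := by funext s; simp [f, h]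
      rw [e]; exact Measure.measurePreserving_sub_left volume 1
    · have e : f t = id := by funext s; simp [f, h]
      rw [e]; exact MeasurePreserving.id volume
  have hpi : MeasurePreserving (fun (a : Fin n → ℝ) (t : Fin n) => f t (a t)) volume volume :=
    volume_preserving_pi hf
  have hsw := volume_measurePreserving_piCongrLeft (fun _ : Fin n => ℝ) (Equiv.swap i j)
  have hcomp := hsw.comp hpi
  have hfun : (⇑(MeasurableEquiv.piCongrLeft (fun _ : Fin n => ℝ) (Equiv.swap i j)) ∘
      fun (a : Fin n → ℝ) (t : Fin n) => f t (a t)) = σ := by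
    funext x t
    simp only [Function.comp, MeasurableEquiv.coe_piCongrLeft, Equiv.piCongrLeft_apply, eq_rec_constant,
      Equiv.symm_swap]
    by_cases hti : t = i
    · rw [hti, Equiv.swap_apply_left, swapReflect_apply_left hσ]
      simp [f]
    · by_cases htj : t = j
      · rw [htj, Equiv.swap_apply_right, swapReflect_apply_right hσ hij]
        simp [f]
      · rw [Equiv.swap_apply_of_ne_of_ne hti htj, swapReflect_apply_of_ne hσ hti htj]
        simp [f, hti, htj]
  rw [hfun] at hcomp
  exact hcomp

/-- `σ` maps the closed unit cube onto itself. [cite: Fischler2003RhinViola, §4.2 Proposition 14 (with Prop. 10)] -/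
private theorem swapReflect_preimage_unitCube
    (hσ : ∀ x t, σ x t = if t = i then 1 - x j else if t = j then 1 - x i else x t) (hij : i ≠ j) :
    σ ⁻¹' unitCube n = unitCube n := by
  ext x
  simp only [Set.mem_preimage, unitCube, Set.mem_univ_pi, Set.mem_Icc]
  constructor
  · intro h t
    by_cases hti : t = i
    · have h1 := h j
      rw [swapReflect_apply_right hσ hij] at h1
      rw [hti]; constructor <;> linarith [h1.1, h1.2]
    · by_cases htj : t = j
      · have h1 := h i
        rw [swapReflect_apply_left hσ] at h1
        rw [htj]; constructor <;> linarith [h1.1, h1.2]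
      · have h1 := h t
        rwa [swapReflect_apply_of_ne hσ hti htj] at h1
  · intro h t
    by_cases hti : t = i
    · rw [hti, swapReflect_apply_left hσ]
      have h1 := h j
      constructor <;> linarith [h1.1, h1.2]
    · by_cases htj : t = j
      · rw [htj, swapReflect_apply_right hσ hij]
        have h1 := h i
        constructor <;> linarith [h1.1, h1.2]
      · rw [swapReflect_apply_of_ne hσ hti htj]; exact h t

/-- With `i = x₁`'s index and `j = x₂`'s index: `(σx)₁ = 1 − x₂`, `(σx)₂ = 1 − x₁`, `(σx)_k = x_k` otherwise
(in the 1-based coordinates `coord`). [cite: Fischler2003RhinViola, §4.2 Proposition 14 (with Prop. 10)] -/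
private theorem coord_swapReflect
    (hσ : ∀ x t, σ x t = if t = i then 1 - x j else if t = j then 1 - x i else x t)
    (hi : i.val = 0) (hj : j.val = 1) (x : Fin n → ℝ) (k : ℕ) :
    coord (σ x) k = if k = 1 then 1 - coord x 2 else if k = 2 then 1 - coord x 1 else coord x k := by
  have hn : 2 ≤ n := by have := j.isLt; omega
  have hij : i ≠ j := by
    intro h; have h' := congrArg Fin.val h; omega
  have c1 : ∀ y : Fin n → ℝ, coord y 1 = y i := by
    intro y
    unfold coord
    rw [dif_pos ⟨le_rfl, by omega⟩]
    congr 1; apply Fin.ext; simp [hi]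
  have c2 : ∀ y : Fin n → ℝ, coord y 2 = y j := by
    intro y
    unfold coord
    rw [dif_pos ⟨by norm_num, hn⟩]
    congr 1; apply Fin.ext; simp [hj]
  by_cases h1 : k = 1
  · subst h1
    rw [if_pos rfl, c1, c2, swapReflect_apply_left hσ]
  · by_cases h2 : k = 2
    · subst h2
      rw [if_neg h1, if_pos rfl, c2, c1, swapReflect_apply_right hσ hij]
    · rw [if_neg h1, if_neg h2]
      by_cases hk : 1 ≤ k ∧ k ≤ n
      · have e : ∀ y : Fin n → ℝ, coord y k = y ⟨k - 1, by omega⟩ := fun y => by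
          unfold coord; rw [dif_pos hk]
        rw [e, e, swapReflect_apply_of_ne hσ]
        · intro h; have h' := congrArg Fin.val h; simp only [hi] at h'; omega
        · intro h; have h' := congrArg Fin.val h; simp only [hj] at h'; omega
      · have e : ∀ y : Fin n → ℝ, coord y k = 0 := fun y => by
          unfold coord; rw [dif_neg hk]
        rw [e, e]

/-- `δ_k(σx) = δ_k(x)` for every `k ≥ 2`. [cite: Fischler2003RhinViola, §4.2 Proposition 14 (with Prop. 10)] -/
private theorem deltaV_swapReflect
    (hσ : ∀ x t, σ x t = if t = i then 1 - x j else if t = j then 1 - x i else x t)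
    (hi : i.val = 0) (hj : j.val = 1) (x : Fin n → ℝ) (k : ℕ) (hk : 2 ≤ k) :
    deltaV (σ x) k = deltaV x k := by
  induction k, hk using Nat.le_induction with
  | base =>
    show 1 - coord (σ x) 2 * (1 - coord (σ x) 1 * 1) = 1 - coord x 2 * (1 - coord x 1 * 1)
    rw [coord_swapReflect hσ hi hj x 2, coord_swapReflect hσ hi hj x 1,
      if_neg (by norm_num : (2 : ℕ) ≠ 1), if_pos rfl, if_pos rfl]
    ring
  | succ k hk ih =>
    show 1 - coord (σ x) (k + 1) * deltaV (σ x) k = 1 - coord x (k + 1) * deltaV x k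
    rw [ih, coord_swapReflect hσ hi hj x (k + 1), if_neg (by omega), if_neg (by omega)]

/-- The integrand of `𝒥(σ(p))` at `x` is the integrand of `𝒥(p)` at `σx`.
[cite: Fischler2003RhinViola, §4.2 Proposition 14 (with Proposition 10)] -/
private theorem integrandJ_sigma_swapReflect
    (hσ : ∀ x t, σ x t = if t = i then 1 - x j else if t = j then 1 - x i else x t)
    (hi : i.val = 0) (hj : j.val = 1) (p : Exponents) (x : Fin n → ℝ) :
    integrandJ n (sigma p) x = integrandJ n p (σ x) := by
  have hn : 2 ≤ n := by have := j.isLt; omega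
  have hnum : (∏ k ∈ Finset.Icc 1 n, coord x k ^ (sigma p).a k * (1 - coord x k) ^ (sigma p).b k) =
      ∏ k ∈ Finset.Icc 1 n, coord (σ x) k ^ p.a k * (1 - coord (σ x) k) ^ p.b k := by
    refine Finset.prod_equiv (Equiv.swap (1 : ℕ) 2) (fun k => ?_) (fun k hk => ?_)
    · simp only [Finset.mem_Icc]
      rw [Equiv.swap_apply_def]
      split_ifs <;> omega
    · by_cases h1 : k = 1
      · subst h1
        rw [Equiv.swap_apply_left, coord_swapReflect hσ hi hj x 2, if_neg (by norm_num : (2 : ℕ) ≠ 1),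
          if_pos rfl, sub_sub_cancel]
        simp only [sigma, if_true]
        ring
      · by_cases h2 : k = 2
        · subst h2
          rw [Equiv.swap_apply_right, coord_swapReflect hσ hi hj x 1, if_pos rfl, sub_sub_cancel]
          simp only [sigma, h1, if_true, if_false]
          ring
        · rw [Equiv.swap_apply_of_ne_of_ne h1 h2, coord_swapReflect hσ hi hj x k, if_neg h1, if_neg h2]
          simp only [sigma, h1, h2, if_false]
  have hden : (∏ k ∈ Finset.Icc 2 n, deltaV x k ^ (sigma p).c k) =
      ∏ k ∈ Finset.Icc 2 n, deltaV (σ x) k ^ p.c k := by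
    refine Finset.prod_congr rfl fun k hk => ?_
    rw [deltaV_swapReflect hσ hi hj x k (Finset.mem_Icc.mp hk).1]
    rfl
  unfold integrandJ
  rw [hnum, hden, deltaV_swapReflect hσ hi hj x n hn]

end JnSigmaProof

/-- **`𝒥` is invariant under `σ` — PROVED** (discharge of the named fact `Jn_sigma`): `𝒥(σ(p)) = 𝒥(p)` in
`ℝ₊ ∪ {∞}` for all `n ≥ 2` and all `p ∈ ℤ^{3n−1}`, by the measure-preserving involution
`x₁ ↦ 1 − x₂, x₂ ↦ 1 − x₁` of `[0,1]^n` (the printed change of variables).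
[cite: Fischler2002Polyzetas, §3 p. 3 (𝒥(p) = 𝒥(σ(p)))] [cite: Fischler2003RhinViola, §4.2 Proposition 14 (with Prop. 10)] -/
theorem Jn_sigma_holds : Jn_sigma := by
  intro n p hn
  let i : Fin n := ⟨0, by omega⟩
  let j : Fin n := ⟨1, by omega⟩
  have hi : i.val = 0 := rfl
  have hj : j.val = 1 := rfl
  have hij : i ≠ j := by
    intro h; have h' := congrArg Fin.val h; rw [hi, hj] at h'; exact absurd h' (by norm_num)
  let σ : (Fin n → ℝ) → (Fin n → ℝ) := fun x t => if t = i then 1 - x j else if t = j then 1 - x i else x t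
  have hσ : ∀ x t, σ x t = if t = i then 1 - x j else if t = j then 1 - x i else x t := fun _ _ => rfl
  have hemb : MeasurableEmbedding σ :=
    (MeasurableEquiv.ofInvolutive σ (swapReflect_involutive hσ hij)
      (measurable_swapReflect hσ)).measurableEmbedding
  have key : ∫⁻ y in unitCube n, ENNReal.ofReal (integrandJ n p (σ y)) =
      ∫⁻ y in unitCube n, ENNReal.ofReal (integrandJ n p y) := by
    have h := (measurePreserving_swapReflect hσ hij).setLIntegral_comp_preimage_emb hemb
      (fun y => ENNReal.ofReal (integrandJ n p y)) (unitCube n)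
    rw [swapReflect_preimage_unitCube hσ hij] at h
    exact h
  unfold Jn
  rw [← key]
  refine lintegral_congr fun x => ?_
  rw [integrandJ_sigma_swapReflect hσ hi hj p x]

end Literature.NumberTheory.Irrationality.Fischler2002
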